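import Summits.Parity.GeneralizedHardyLittlewood.Theorems.Dhl42TablesMono
import Summits.Parity.GeneralizedHardyLittlewood.Theorems.Dhl42DefsCover

/-!
# Sanity instances for the depth-band predicate `inBand` (review-runbook card D91)

`inBand g s := bandLo g ≤ Sc - s ∧ Sc - s < eps2 g` with `bandLo = ![eps2 1, eps2 2, 0]`
(`Dhl42DefsCover.lean` :47–50).  With `eps2C_pos : 0 < eps2 2` and
`eps2_anti : eps2 2 < eps2 1 ∧ eps2 1 < eps2 0` (`Dhl42TablesMono.lean` :27–32) the three bands
`[eps2 1, eps2 0)`, `[eps2 2, eps2 1)`, `[0, eps2 2)` of the depth `Sc - s` are non-empty, pairwise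
disjoint and tile `[0, eps2 0)`: a holds-instance, a fails-instance, exhaustiveness and uniqueness.
Written by the pub-dhl42 writer seat (gen 36, 2026-08-20, `FROM-pub-dhl42-w-g36-Dhl42Sanity.lean`) for the
ops-runbook sanity registry; landed by ops-runbook gen 16 (2026-08-21). No new definitions.
-/

namespace Summit.Parity.GeneralizedHardyLittlewood.Theorems.Dhl42

/-- The lower edge of band `0` is `ε_{2,2}` (`eps2 1`). -/
@[simp] theorem bandLo_zero : bandLo 0 = eps2 1 := rfl
/-- The lower edge of band `1` is `ε_{2,3}` (`eps2 2`). -/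
@[simp] theorem bandLo_one : bandLo 1 = eps2 2 := rfl
/-- The lower edge of band `2` is `0` (`ε_{2,4} := 0`). -/
@[simp] theorem bandLo_two : bandLo 2 = 0 := rfl

/-- Holds-instance: the apex depth `Sc - Sc = 0` lies in the deepest band `g = 2`. -/
theorem inBand_two_Sc : inBand 2 Sc := by
  refine ⟨?_, ?_⟩
  · simp
  · simpa using eps2C_pos

/-- Fails-instance: the apex depth `0` is not in band `g = 0` (its lower edge `eps2 1` is positive). -/
theorem not_inBand_zero_Sc : ¬ inBand 0 Sc := by
  rintro ⟨h, -⟩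
  have h' : eps2 1 ≤ 0 := by simpa using h
  linarith [eps2C_pos, eps2_anti.1]

/-- Exhaustiveness: every depth in `[0, eps2 0)` lies in some band. -/
theorem inBand_exists (s : ℝ) (h0 : 0 ≤ Sc - s) (h1 : Sc - s < eps2 0) : ∃ g, inBand g s := by
  by_cases ha : eps2 1 ≤ Sc - s
  · exact ⟨0, by simpa using ha, h1⟩
  · by_cases hb : eps2 2 ≤ Sc - s
    · exact ⟨1, by simpa using hb, lt_of_not_ge ha⟩
    · exact ⟨2, by simpa using h0, lt_of_not_ge hb⟩

/-- Uniqueness: the bands are pairwise disjoint. -/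
theorem inBand_unique {g g' : Fin 3} {s : ℝ} (h : inBand g s) (h' : inBand g' s) : g = g' := by
  obtain ⟨hl, hu⟩ := h
  obtain ⟨hl', hu'⟩ := h'
  have ha := eps2_anti
  fin_cases g <;> fin_cases g' <;> simp_all <;> linarith

/-- Every lower band edge is nonnegative. -/
theorem bandLo_nonneg (g : Fin 3) : 0 ≤ bandLo g := by
  have ha := eps2_anti
  have hc := eps2C_pos
  fin_cases g <;> norm_num [bandLo] <;> linarith [ha.1, ha.2, hc]

/-- Every upper band edge is at most the top edge `eps2 0`. -/
theorem eps2_le_eps2_zero : ∀ g : Fin 3, eps2 g ≤ eps2 0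
  | ⟨0, _⟩ => le_rfl
  | ⟨1, _⟩ => eps2_anti.2.le
  | ⟨2, _⟩ => (eps2_anti.1.trans eps2_anti.2).le
  | ⟨n + 3, h⟩ => absurd h (by omega)

/-- Converse bound: a point in any band has depth in `[0, eps2 0)`. -/
theorem inBand_depth {g : Fin 3} {s : ℝ} (h : inBand g s) : 0 ≤ Sc - s ∧ Sc - s < eps2 0 :=
  ⟨(bandLo_nonneg g).trans h.1, h.2.trans_le (eps2_le_eps2_zero g)⟩

end Summit.Parity.GeneralizedHardyLittlewood.Theorems.Dhl42
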